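import Mathlib
import Summits.ValiantsHypothesis.ValiantsHypothesis.Theorems.DivisionGapDefs

/-!
# Crux `DivisionGap.PerDivisionHard` (stmt-ValiantsHypothesis-5065), line `pair-descent-jss-endpoint` —
stub `stub_walkStepMargins`: the margins of one walk step

The exponent vector of one step of the walk-sum cofactor `h_walk` with bookkeeping row `ρ₀` and
default column `a₀`,
`e = e_{(R,Cᵢₙ)} + 2e_{(R,Cₒᵤₜ)} + Σ_{R' ≠ R} 3e_{(R',a₀)} + Σ_{C ≠ Cᵢₙ} e_{(ρ₀,C)} + Σ_{C ≠ Cₒᵤₜ} 2e_{(ρ₀,C)}`,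
has row degrees `3` except `3n` at `ρ₀` and column degrees `3` except `3n` at `a₀`, whatever
`(R, Cᵢₙ, Cₒᵤₜ)` is (also in the degenerate cases `R = ρ₀`, `Cᵢₙ = Cₒᵤₜ`, `a₀ ∈ {Cᵢₙ, Cₒᵤₜ}`).
Row `R` gets `1 + 2`, every row `R' ≠ R` gets `3` from the default column, and row `ρ₀` gets in
addition `(n - 1) + 2(n - 1)`; column `a₀` gets `3(n - 1)` from the default cells, and every
column gets exactly `1 + 2` from the remaining four summands.  Hence every product of steps has
the same margins, i.e. the walk sums are torus-homogeneous.  The proof pushes the additive maps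
`rowDegrees = mapDomain Prod.fst` and `mapDomain Prod.snd` through the sums, evaluates the
singles and counts (`Finset.sum_ite_eq'`, `Finset.card_erase_of_mem`). [folklore]
-/

noncomputable section

-- the tree's mandated layout duplicates the namespace component `ValiantsHypothesis`
set_option linter.dupNamespace false

namespace Summit.ValiantsHypothesis.ValiantsHypothesis.Theorems.DivisionGapPerDivisionHard

open MvPolynomial Literature.Computability.AlgebraicComplexity
open scoped NNReal BigOperators

/-- **Margins of one walk step are independent of the step.**  The exponent vector
`e = e_{(R,Cᵢₙ)} + 2e_{(R,Cₒᵤₜ)} + Σ_{R' ≠ R} 3e_{(R',a₀)} + Σ_{C ≠ Cᵢₙ} e_{(ρ₀,C)} + Σ_{C ≠ Cₒᵤₜ} 2e_{(ρ₀,C)}`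
of one walk step with bookkeeping row `ρ₀` and default column `a₀` has row degrees `3` except
`3n` at `ρ₀` and column degrees `3` except `3n` at `a₀`, for every `(R, Cᵢₙ, Cₒᵤₜ)`. [folklore] -/
theorem stub_walkStepMargins :
    ∀ (n : ℕ) (ρ₀ a₀ R Cin Cout : Fin n) (e : (Fin n × Fin n) →₀ ℕ),
      e = Finsupp.single (R, Cin) 1 + Finsupp.single (R, Cout) 2 +
          ∑ R' ∈ Finset.univ.erase R, Finsupp.single (R', a₀) 3 +
          ∑ C ∈ Finset.univ.erase Cin, Finsupp.single (ρ₀, C) 1 +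
          ∑ C ∈ Finset.univ.erase Cout, Finsupp.single (ρ₀, C) 2 →
      (∀ r : Fin n, rowDegrees e r = if r = ρ₀ then 3 * n else 3) ∧
      (∀ c : Fin n, Finsupp.mapDomain Prod.snd e c = if c = a₀ then 3 * n else 3) := by
  intro n ρ₀ a₀ R Cin Cout e he
  subst he
  have hn : 1 ≤ n := Nat.one_le_of_lt ρ₀.isLt
  refine ⟨fun r => ?_, fun c => ?_⟩
  · simp only [rowDegrees, Finsupp.mapDomain_add, Finsupp.mapDomain_finsetSum,
      Finsupp.mapDomain_single, Finsupp.coe_add, Pi.add_apply, Finsupp.coe_finsetSum,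
      Finset.sum_apply, Finsupp.single_apply, Finset.sum_ite_eq', Finset.sum_const,
      Finset.card_erase_of_mem (Finset.mem_univ _), Finset.card_univ, Fintype.card_fin,
      Finset.mem_erase, Finset.mem_univ, Finsupp.coe_smul, Pi.smul_apply, smul_eq_mul,
      and_true, ne_eq, ite_not, mul_ite, mul_zero]
    split_ifs <;> omega
  · simp only [Finsupp.mapDomain_add, Finsupp.mapDomain_finsetSum,
      Finsupp.mapDomain_single, Finsupp.coe_add, Pi.add_apply, Finsupp.coe_finsetSum,
      Finset.sum_apply, Finsupp.single_apply, Finset.sum_ite_eq', Finset.sum_const,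
      Finset.card_erase_of_mem (Finset.mem_univ _), Finset.card_univ, Fintype.card_fin,
      Finset.mem_erase, Finset.mem_univ, Finsupp.coe_smul, Pi.smul_apply, smul_eq_mul,
      and_true, ne_eq, ite_not, mul_ite, mul_zero]
    split_ifs <;> omega

end Summit.ValiantsHypothesis.ValiantsHypothesis.Theorems.DivisionGapPerDivisionHard
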